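import Mathlib
import HarnessLib
import Summits.ResolutionOfSingularities.ResolutionOfSingularities.Theorems.HomologicalConductorSurfaceTerminationCentreRing
import Summits.ResolutionOfSingularities.ResolutionOfSingularities.Theorems.SyzygyFlatteningHigherRankTerminationRankLeOneDimZero

/-!
# Route `HomologicalConductor`, kill test `SurfaceTermination` (stmt-ResolutionOfSingularities-16488):
# the CENTRE-RING DICTIONARY of one resolution of a stage, part 2: CENTRES, CURVE DETECTION, and the
# assembly `exists_centreRing_tower` (= stub `stub_centreRing` of `DescentSketch.lean`, verbatim)

OURS (cell res-hironaka, crux chain W4.4, seat res-L0-w44-stub-4; object named by res-L0-w44-plan-1 g12,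
2026-08-27T09:17:11Z (c)); nothing here is a statement of the manuscript under review (Hironaka 2017);
AI-written, weaker than expert review.  SUPPORT-level (kill test K4.4-s), mechanism-neutral: consumed by both
candidate (R2) mechanisms of K44S-DESCENT.  Continues `…SurfaceTerminationCentreRing` (the local rings
`𝒪_{X,x} ⊆ K` of a `T`-model `π : X ⟶ Spec T`, `T ⊆ K`, `K(X) ≅ K` over `T`):

* §2 CENTRES (`exists_centre`): for `π` universally closed, a valuation ring `V ⊇ T` of `K` DOMINATES some
  `𝒪_{X,x}` — the existence half of the valuative criterion (EGA II 7.3.8; Mathlib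
  `UniversallyClosed.eq_valuativeCriterion`) applied to the square `Spec K → X`, `Spec V → Spec T`, read back
  in `K` through the monomorphism `Spec 𝒪_{X,x} → X`;
* §3 CURVE DETECTION (`mem_excCurvePoints_of_coe_eq`): on a resolution of a two-dimensional normal singular `T`,
  if `𝒪_{X,x}` IS a valuation ring `V ≠ K` relatively dominating `T` then `x ∈ excCurvePoints π` (`x` is in
  the closed fibre and `𝒪_{X,x} ≅ V` is a noetherian valuation ring, a DVR, of dimension one);
* §4 `exists_centreRing_tower`: the statement of `stub_centreRing` of the (R2) skeleton `DescentSketch.lean`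
  at a singular stage `tower O A (n+1)` of the canonical `ca`-tower (`K(X) ≅ K` from
  `isFractionRing_baseToFunctionField`).

References: O. Zariski, P. Samuel, *Commutative Algebra* II (1960), Ch. VI §17 [`ZariskiSamuel1960`];
A. Grothendieck, EGA II (1961), 7.3.8 [`EGAII`]; J. Lipman, Publ. Math. IHÉS 36 (1969) §12 [`Lipman1969`].
-/

noncomputable section

-- single-problem summit: the doubled namespace component `ResolutionOfSingularities` is forced
set_option linter.dupNamespace false

namespace Summit.ResolutionOfSingularities.ResolutionOfSingularities.Theorems.SurfaceTermination.CentreRing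

open CategoryTheory AlgebraicGeometry TopologicalSpace IsLocalRing
open Literature.AlgebraicGeometry.Resolution Literature.AlgebraicGeometry.Motives
open Summit.ResolutionOfSingularities.ResolutionOfSingularities.Theorems.NoZeno.Birth
open Summit.ResolutionOfSingularities.ResolutionOfSingularities.Theorems.NoZeno.SandwichCluster

variable {k K : Type} [Field k] [Field K] [Algebra k K]

/-! ## §2 Centres: the existence half of the valuative criterion -/

section Centre

variable (T : Subalgebra k K) {X : Scheme.{0}} [IsIntegral X] (π : X ⟶ Spec (.of ↥T))
  (e : ↑X.functionField ≃+* K) (he : ∀ t : ↥T, e (baseToFunctionField π t) = (t : K))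
include he

/-- **The distinguished `K`-point lies over `Spec K → Spec T`.**  With `gen = Spec(e) ≫ (Spec 𝒪_{X,ξ} → X)`:
`gen ≫ π = Spec (T ⊆ K)`. [folklore] -/
theorem specMap_comp_fromSpecStalk_comp :
    Spec.map (CommRingCat.ofHom (e : ↑X.functionField →+* K)) ≫ X.fromSpecStalk (genericPoint X) ≫ π =
      Spec.map (CommRingCat.ofHom (algebraMap ↥T K)) := by
  rw [← Scheme.SpecMap_stalkMap_fromSpecStalk, Spec.fromSpecStalk_eq, ← Spec.map_comp, ← Spec.map_comp]
  congr 1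
  ext t
  change e ((π.stalkMap (genericPoint X)).hom (((Spec (.of ↥T)).presheaf.germ ⊤ _ trivial).hom
    ((Scheme.ΓSpecIso (.of ↥T)).inv.hom t))) = (t : K)
  rw [Scheme.Hom.germ_stalkMap_apply, ← he t]
  rfl

/-- **Centres exist** (EGA II 7.3.8): for `π` universally closed (e.g. proper) and a valuation ring `V` of `K`
containing `T`, some local ring `𝒪_{X,x} ⊆ K` is DOMINATED by `V`: `𝒪_{X,x} ⊆ V` and an element of
`𝒪_{X,x}` inverted in `V` is inverted in `𝒪_{X,x}`. [cite: EGAII, 7.3.8] -/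
theorem exists_centre [UniversallyClosed π] (V : ValuationSubring K) (hTV : T.toSubring ≤ V.toSubring) :
    ∃ x : X, ((RatFn.toFunctionField x).range).map e.toRingHom ≤ V.toSubring ∧
      ∀ z ∈ ((RatFn.toFunctionField x).range).map e.toRingHom, z⁻¹ ∈ V → z⁻¹ ∈
        ((RatFn.toFunctionField x).range).map e.toRingHom := by
  classical
  -- the valuative square
  let ι : ↥T →+* ↥V := (T.val.toRingHom).codRestrict V.toSubring fun t => hTV t.2
  have hι : (algebraMap ↥V K).comp ι = algebraMap ↥T K := RingHom.ext fun _ => rfl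
  let gen : Spec (.of K) ⟶ X :=
    Spec.map (CommRingCat.ofHom (e : ↑X.functionField →+* K)) ≫ X.fromSpecStalk (genericPoint X)
  have hsq : CommSq gen (Spec.map (CommRingCat.ofHom (algebraMap ↥V K))) π
      (Spec.map (CommRingCat.ofHom ι)) := by
    refine ⟨?_⟩
    rw [← Spec.map_comp, ← CommRingCat.ofHom_comp, hι]
    exact (Category.assoc _ _ _).trans (specMap_comp_fromSpecStalk_comp T π e he)
  let S : ValuativeCommSq π := ⟨↥V, K, gen, Spec.map (CommRingCat.ofHom ι), hsq⟩
  have hex : ValuativeCriterion.Existence π := by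
    have h := (inferInstance : UniversallyClosed π)
    rw [UniversallyClosed.eq_valuativeCriterion] at h
    exact h.1
  obtain ⟨l, hl₁, -⟩ := (hex S).exists_lift
  -- the centre and the local homomorphism `𝒪_{X,x} → V`
  haveI : IsLocalRing (CommRingCat.of ↥V) := inferInstanceAs (IsLocalRing ↥V)
  set x := l.base (closedPoint (CommRingCat.of ↥V)) with hx
  let φ : X.presheaf.stalk x ⟶ CommRingCat.of ↥V := Scheme.stalkClosedPointTo l
  -- `V.subtype ∘ φ = e ∘ toFunctionField x`: both induce `gen` through `Spec 𝒪_{X,x} → X`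
  have hφ : (algebraMap ↥V K).comp φ.hom = (e : ↑X.functionField →+* K).comp (RatFn.toFunctionField x) := by
    have h1 : Spec.map (CommRingCat.ofHom ((algebraMap ↥V K).comp φ.hom)) ≫ X.fromSpecStalk x = gen := by
      rw [show CommRingCat.ofHom ((algebraMap ↥V K).comp φ.hom) =
          φ ≫ CommRingCat.ofHom (algebraMap ↥V K) from rfl, Spec.map_comp, Category.assoc,
        Scheme.Spec_stalkClosedPointTo_fromSpecStalk]
      exact hl₁
    have h2 : Spec.map (CommRingCat.ofHom ((e : ↑X.functionField →+* K).comp (RatFn.toFunctionField x))) ≫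
        X.fromSpecStalk x = gen := by
      rw [show CommRingCat.ofHom ((e : ↑X.functionField →+* K).comp (RatFn.toFunctionField x)) =
          X.presheaf.stalkSpecializes ((genericPoint_spec X).specializes (Set.mem_univ x)) ≫
            CommRingCat.ofHom (e : ↑X.functionField →+* K) from rfl, Spec.map_comp, Category.assoc,
        Scheme.SpecMap_stalkSpecializes_fromSpecStalk]
      rfl
    have h3 : Spec.map (CommRingCat.ofHom ((algebraMap ↥V K).comp φ.hom)) =
        Spec.map (CommRingCat.ofHom ((e : ↑X.functionField →+* K).comp (RatFn.toFunctionField x))) := by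
      rw [← cancel_mono (X.fromSpecStalk x), h1, h2]
    exact congrArg CommRingCat.Hom.hom (Spec.map_injective h3)
  have hval : ∀ s, ((φ.hom s : ↥V) : K) = e (RatFn.toFunctionField x s) := fun s => RingHom.congr_fun hφ s
  refine ⟨x, fun z hz => ?_, fun z hz hzinv => ?_⟩
  · obtain ⟨s, rfl⟩ := (mem_stalkSubring_iff e x).mp hz
    rw [← hval]; exact (φ.hom s).2
  · obtain ⟨s, rfl⟩ := (mem_stalkSubring_iff e x).mp hz
    by_cases h0 : e (RatFn.toFunctionField x s) = 0
    · rw [h0, inv_zero]; exact Subring.zero_mem _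
    have hu : IsUnit (φ.hom s) := by
      rw [isUnit_iff_exists_inv]
      refine ⟨⟨(e (RatFn.toFunctionField x s))⁻¹, hzinv⟩, Subtype.ext ?_⟩
      change ((φ.hom s : ↥V) : K) * (e (RatFn.toFunctionField x s))⁻¹ = 1
      rw [hval, mul_inv_cancel₀ h0]
    obtain ⟨v, hv⟩ := (isUnit_map_iff φ.hom s).mp hu
    refine (mem_stalkSubring_iff e x).mpr ⟨(↑v⁻¹ : X.presheaf.stalk x), ?_⟩
    refine (eq_inv_of_mul_eq_one_left ?_)
    rw [← map_mul, ← map_mul, ← hv, Units.inv_mul, map_one, map_one]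

end Centre

/-! ## §3 Curve detection -/

section Curve

variable (T : Subalgebra k K) {X : Scheme.{0}} [IsIntegral X] (π : X ⟶ Spec (.of ↥T))
  (e : ↑X.functionField ≃+* K) (he : ∀ t : ↥T, e (baseToFunctionField π t) = (t : K))
include he

/-- **Curve detection.**  On a resolution `π : X ⟶ Spec T` of a two-dimensional normal singular `T`: if the
local ring `𝒪_{X,x} ⊆ K` IS a valuation ring `V ≠ K` which relatively dominates `T`, then `x` is an integral
exceptional curve point — `x` lies in the closed fibre, and `𝒪_{X,x} ≅ V` is a noetherian valuation ring,
i.e. a DVR, of dimension one. [cite: Lipman1969, Section 12 (p. 220)] -/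
theorem mem_excCurvePoints_of_coe_eq [IsNoetherianRing ↥T] [IsLocalRing ↥T] [IsIntegrallyClosed ↥T]
    (hdim : ringKrullDim ↥T = 2) (hsing : ¬ IsRegularLocalRing ↥T) (hπ : IsResolution π) (x : X)
    (V : ValuationSubring K) (hV : V ≠ ⊤) (hdomT : ∀ t ∈ T, t⁻¹ ∈ V → t⁻¹ ∈ T)
    (heq : (((RatFn.toFunctionField x).range).map e.toRingHom : Set K) = (V : Set K)) :
    x ∈ excCurvePoints π := by
  have heq' : ((RatFn.toFunctionField x).range).map e.toRingHom = V.toSubring := SetLike.coe_injective heq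
  -- closed fibre
  have hx : π.base x = closedPoint ↥T :=
    base_eq_closedPoint_of_le T π e he x V.toSubring heq'.le hdomT
  -- `𝒪_{X,x} ≅ V` is a DVR
  haveI : IsRegularLocalRing (X.presheaf.stalk x) := hπ.isRegular x
  let ε : X.presheaf.stalk x ≃+* ↥V :=
    (RingEquiv.ofBijective _ (bijective_codRestrict e x)).trans (RingEquiv.subringCongr heq')
  haveI : IsNoetherianRing ↥V := isNoetherianRing_of_ringEquiv (X.presheaf.stalk x) ε
  haveI : IsDiscreteValuationRing ↥V :=
    ((IsDiscreteValuationRing.TFAE ↥V (SyzygyFlattening.rankLeOne_not_isField V hV)).out 0 1).mpr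
      (show ValuationRing ↥V from inferInstance)
  have h1 : Order.coheight x = 1 := by
    have h := ringKrullDim_stalk_eq_coheight x
    rw [ringKrullDim_eq_of_ringEquiv ε, IsDiscreteValuationRing.ringKrullDim_eq_one] at h
    exact_mod_cast h.symm
  exact hπ.mem_excCurvePoints_of_coheight_eq_one hdim hsing hx h1

end Curve

/-! ## §4 Assembly at a stage of the canonical tower: `stub_centreRing` of `DescentSketch.lean` -/

section Tower

/-- **The centre-ring dictionary of one resolution of a singular stage** (= `stub_centreRing` of the (R2)
skeleton `DescentSketch.lean`, VERBATIM).  For the singular stage `T = tower O A (n+1)` (a two-dimensional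
normal Noetherian local domain, essentially of finite type over `k`, `Frac T = K`) and a resolution
`π : X ⟶ Spec T`: the local rings of `X` inside `K` form a map `ctr : X → Subalgebra k K` with (a) `T ≤ ctr x`,
`ctr x` regular local, integrally closed in `K`, essentially of finite type over `k`; (b) CENTRES — every
valuation ring `V ⊇ T` of `K` relatively dominating `T` dominates some `ctr x`; (c) CURVE DETECTION — if `ctr x`
is a valuation ring `V ≠ K` relatively dominating `T` then `x ∈ excCurvePoints π`.
[cite: ZariskiSamuel1960, Ch. VI §17] -/
theorem exists_centreRing_tower (O : ValuationSubring K) (A : Subalgebra k K)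
    (hk : ∀ c : k, algebraMap k K c ∈ O) (hA : A.FG) (hfr : IsFractionRing ↥A K)
    (hAO : A.toSubring ≤ O.toSubring) (htr : Algebra.trdeg k K = 2) (n : ℕ)
    (hsing : ¬ IsRegularLocalRing ↥(tower O A (n + 1))) [IsLocalRing ↥(tower O A (n + 1))]
    (X : Scheme.{0}) (π : X ⟶ Spec (.of ↥(tower O A (n + 1)))) (hπ : IsResolution π) :
    ∃ ctr : X → Subalgebra k K,
      (∀ x, tower O A (n + 1) ≤ ctr x) ∧
      (∀ x, IsRegularLocalRing ↥(ctr x)) ∧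
      (∀ x, ∀ y : K, IsIntegral ↥(ctr x) y → y ∈ ctr x) ∧
      (∀ x, Algebra.EssFiniteType k ↥(ctr x)) ∧
      (∀ V : ValuationSubring K, (tower O A (n + 1)).toSubring ≤ V.toSubring →
        (∀ t ∈ tower O A (n + 1), t⁻¹ ∈ V → t⁻¹ ∈ tower O A (n + 1)) →
        ∃ x, (ctr x).toSubring ≤ V.toSubring ∧ ∀ s ∈ ctr x, s⁻¹ ∈ V → s⁻¹ ∈ ctr x) ∧
      (∀ x, ∀ V : ValuationSubring K, V ≠ ⊤ →
        (∀ t ∈ tower O A (n + 1), t⁻¹ ∈ V → t⁻¹ ∈ tower O A (n + 1)) →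
        ((ctr x : Set K) = (V : Set K)) → x ∈ excCurvePoints π) := by
  classical
  haveI := hfr
  -- the stage: noetherian, normal, essentially of finite type, `Frac = K`, dimension two
  haveI : IsNoetherianRing ↥(tower O A (n + 1)) := stub_towerNoetherian k K O A hk hA hfr hAO _
  haveI : IsIntegrallyClosed ↥(tower O A (n + 1)) := d2rc_isIntegrallyClosed_tower_succ O A hk hA hfr hAO n
  haveI : IsFractionRing ↥(tower O A (n + 1)) K :=
    isFractionRing_subalgebra_of_le A (tower O A (n + 1)) (tn_tower_invariant O A hk hA hfr hAO (n + 1)).1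
  have hET : Algebra.EssFiniteType k ↥(tower O A (n + 1)) :=
    (tn_tower_invariant O A hk hA hfr hAO (n + 1)).2.2
  have hdimT : ringKrullDim ↥(tower O A (n + 1)) = 2 :=
    ringKrullDim_tower_eq_two_of_not_isRegularLocalRing O A hk hA hfr hAO htr n hsing
  -- the resolution: integral, proper
  haveI : IsIntegral X := hπ.isIntegral_source
  haveI : IsProper π := hπ.isProper
  -- `K(X) ≅ K` over the stage
  letI := (baseToFunctionField π).toAlgebra
  haveI := hπ.isBirational.isDominant
  haveI : IsFractionRing ↥(tower O A (n + 1)) ↑X.functionField :=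
    isFractionRing_baseToFunctionField π hπ.isBirational.isIso_stalkMap_genericPoint
  let eA : ↑X.functionField ≃ₐ[↥(tower O A (n + 1))] K :=
    IsLocalization.algEquiv (nonZeroDivisors ↥(tower O A (n + 1))) _ _
  let e : ↑X.functionField ≃+* K := eA.toRingEquiv
  have he : ∀ t : ↥(tower O A (n + 1)), e (baseToFunctionField π t) = (t : K) := fun t => eA.commutes t
  -- the centre rings
  let ctr : X → Subalgebra k K := fun x =>
    { toSubsemiring := (((RatFn.toFunctionField x).range).map e.toRingHom).toSubsemiring
      algebraMap_mem' := fun c =>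
        toSubring_le_stalkSubring (tower O A (n + 1)) π e he x
          (Subalgebra.mem_toSubring.mpr ((tower O A (n + 1)).algebraMap_mem c)) }
  have hctr : ∀ x, (ctr x).toSubring = ((RatFn.toFunctionField x).range).map e.toRingHom :=
    fun x => SetLike.coe_injective rfl
  have hmem : ∀ x (z : K), z ∈ ctr x ↔ z ∈ ((RatFn.toFunctionField x).range).map e.toRingHom :=
    fun x z => Iff.rfl
  refine ⟨ctr, fun x t ht => ?_, fun x => ?_, fun x y hy => ?_, fun x => ?_, fun V hTV _ => ?_,
    fun x V hV hdomT heq => ?_⟩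
  · exact (hmem x t).mpr
      (toSubring_le_stalkSubring (tower O A (n + 1)) π e he x (Subalgebra.mem_toSubring.mpr ht))
  · haveI := hπ.isRegular x
    haveI := isRegularLocalRing_stalkSubring e x
    exact IsRegularLocalRing.of_ringEquiv (R := ↥(((RatFn.toFunctionField x).range).map e.toRingHom))
      ((RingEquiv.subringCongr (hctr x).symm).trans (RingEquiv.refl _))
  · haveI := hπ.isRegular x
    exact mem_of_isIntegral (tower O A (n + 1)) π e he x (ctr x) (hctr x) y hy
  · exact essFiniteType_of (tower O A (n + 1)) π e he hET x (ctr x) (hctr x)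
  · obtain ⟨x, hxV, hdom⟩ := exists_centre (tower O A (n + 1)) π e he V hTV
    exact ⟨x, fun z hz => hxV ((hmem x z).mp (Subalgebra.mem_toSubring.mp hz)),
      fun z hz hzi => (hmem x _).mpr (hdom z ((hmem x z).mp hz) hzi)⟩
  · exact mem_excCurvePoints_of_coe_eq (tower O A (n + 1)) π e he hdimT hsing hπ x V hV hdomT heq

end Tower

end Summit.ResolutionOfSingularities.ResolutionOfSingularities.Theorems.SurfaceTermination.CentreRing

end
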